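import Summits.SmoothPoincare4.SmoothPoincare4.Theorems.EntropyRungConicalGapRicciNormSqCutoff
import HarnessLib

/-!
# Helper `helper_ricciNormSq_integrable` of line `Sketch`
(crux `EntropyRung.ConicalGap`, stmt-SmoothPoincare4-16589; lead seat c4, cycle 4)

**The weighted `L²` bound for the Ricci tensor at every scale** (Munteanu–Sesum 2013, Thm. 1.5 /
proof of Thm. 1.4: `∫_M |Ric|² e^{-λ f} < ∞` for every `λ > 0` on a complete gradient shrinking Ricci
soliton). On a gradient shrinker `Ric + Hess f = g/2`, `R + |∇f|² = f`, with proper potential and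
`R ≥ 0` (both theorems of the tree on complete connected normalised 4-d shrinkers), for EVERY `τ > 0`
the weights

  `|Ric|² e^{-f/τ}`  and  `g⁻¹(dR, df) e^{-f/τ}`

are `dV`-integrable — the two provisos of the Ricci moment identity of this line
(`helper_ricciMomentIdentity`, `EntropyRungConicalGapRicciMomentIdentity.lean`), which thereby becomes
unconditional. Proof: the cut-off bound of `EntropyRungConicalGapRicciNormSqCutoff.lean`
(`ricciNormSq_cutoff_integral_le`, uniform in the cut-off radius `ρ`) along `ρ = k + 1 → ∞` and
Fatou (`integrable_of_forall_integral_cutoff_mul_le`) give `|Ric|² e^{-f/τ} ∈ L¹`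
(`ricciNormSq_integrable`); then `|g⁻¹(dR, df)| ≤ 2 √|Ric|² f ≤ |Ric|² + f²`
(`ricciNormSq_abs_innerDual_le`) gives `g⁻¹(dR, df) e^{-f/τ} ∈ L¹`
(`ricciNormSq_innerDual_integrable`). Everything here is proved; no definition and no named fact is
introduced.

## References

* O. Munteanu, N. Sesum, *On gradient Ricci solitons*, J. Geom. Anal. 23 (2013) 539–561, Thm. 1.4,
  Thm. 1.5 and their proofs. [MunteanuSesum2013]
* [CarrilloNi2009] J. Carrillo, L. Ni, Comm. Anal. Geom. 17 (2009) 721–753, §2, Cor. 2.1 (cut-off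
  technique and Fatou).
-/

noncomputable section

-- `Summit.SmoothPoincare4.SmoothPoincare4.…` (summit = problem) trips `dupNamespace` on every decl.
set_option linter.dupNamespace false

open scoped Manifold ContDiff ENNReal NNReal Topology
open MeasureTheory Set Filter
open Literature.Geometry.Lorentzian Literature.Geometry.Riemannian

namespace Summit.SmoothPoincare4.SmoothPoincare4.Theorems.ConicalGapSketch

open CarrilloNi2009_shrinkerLSI

/-! ## A cut-off profile with bounded derivative -/

/-- A smooth cut-off profile on `ℝ`: `1` on `(−∞, 1]`, `0` on `[2, ∞)`, values in `[0, 1]`, with a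
bounded derivative (`CarrilloNi2009_shrinkerLSI.exists_cutoffProfile`, restated with the bound `C ≥ 0`). -/
theorem ricciNormSq_exists_cutoffProfile :
    ∃ φ : ℝ → ℝ, ContDiff ℝ ∞ φ ∧ (∀ t ≤ 1, φ t = 1) ∧ (∀ t, 2 ≤ t → φ t = 0) ∧
      (∀ t, 0 ≤ φ t ∧ φ t ≤ 1) ∧ ∃ C : ℝ, 0 ≤ C ∧ ∀ t, |deriv φ t| ≤ C := by
  obtain ⟨φ, hφs, hφ1, hφ0, hφ01, C, hC⟩ := exists_cutoffProfile
  exact ⟨φ, hφs, hφ1, hφ0, hφ01, C, (abs_nonneg _).trans (hC 0), hC⟩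

/-! ## Integrability over `g.riemVolume` (any dimension) -/

section ProperGreen

variable {n : ℕ} {M : Type*} [TopologicalSpace M] [ChartedSpace (EuclideanSpace ℝ (Fin n)) M]
  [IsManifold (𝓡 n) ∞ M] [T3Space M] [MeasurableSpace M] [BorelSpace M]
  {g : PseudoRiemannianMetric (𝓡 n) ∞ (EuclideanSpace ℝ (Fin n)) (TangentSpace (𝓡 n) : M → Type _)}
  {f : M → ℝ} [g.HasLeviCivita]

/-- **`|Ric|² e^{-f/τ}` is integrable for every `τ > 0`** on a gradient shrinker with proper potential
and `R ≥ 0` (Munteanu–Sesum 2013, Thm. 1.5 / proof of Thm. 1.4, weight `e^{-λf}`, `λ = τ⁻¹ > 0`):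
the cut-off bound `ricciNormSq_cutoff_integral_le` along `ρ = k + 1` and Fatou
(`integrable_of_forall_integral_cutoff_mul_le`). -/
theorem ricciNormSq_integrable (hg : g.IsRiemannian) (hf : ContMDiff (𝓡 n) 𝓘(ℝ, ℝ) ∞ f)
    (hsol : ∀ (x : M) (X Y : TangentSpace (𝓡 n) x),
      g.ricci x X Y + g.hessian f x X Y = (1 / 2 : ℝ) * g.val x X Y)
    (hnorm : ∀ x : M, g.scalarCurvature x + g.gradSq f x = f x)
    (hprop : ∀ R : ℝ, IsCompact {x | f x ≤ R}) (hR0 : ∀ x, 0 ≤ g.scalarCurvature x) {τ : ℝ}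
    (hτ : 0 < τ) :
    Integrable (fun x ↦ g.normSq x (g.ricci x) * Real.exp (-f x / τ)) g.riemVolume := by
  classical
  haveI := isFiniteMeasureOnCompacts_riemVolume hg
  obtain ⟨φ, hφs, hφ1, hφ0, hφ01, C, -, hC⟩ := ricciNormSq_exists_cutoffProfile
  set F : M → ℝ := fun x ↦ g.normSq x (g.ricci x) * Real.exp (-f x / τ) with hF
  have hFc : Continuous F :=
    (g.contMDiff_normSq_ricci').continuous.mul (Real.continuous_exp.comp (hf.continuous.neg.div_const _))
  have hF0 : ∀ x, 0 ≤ F x := fun x ↦ mul_nonneg (g.normSq_nonneg x hg _) (Real.exp_pos _).le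
  set χ : ℕ → M → ℝ := fun k x ↦ φ (f x / (k + 1)) ^ 2 with hχ
  have hχc : ∀ k, Continuous (χ k) := fun k ↦
    (hφs.continuous.comp (hf.continuous.div_const _)).pow 2
  have hχsupp : ∀ k : ℕ, HasCompactSupport (χ k) := fun k ↦ by
    refine HasCompactSupport.intro (hprop (2 * (k + 1))) fun x hx ↦ ?_
    have hx' : 2 * ((k : ℝ) + 1) < f x := lt_of_not_ge hx
    have hk : (0 : ℝ) < k + 1 := by positivity
    have h0 : φ (f x / (k + 1)) = 0 := hφ0 _ (by rw [le_div_iff₀ hk]; linarith)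
    show φ (f x / (k + 1)) ^ 2 = 0
    rw [h0]
    norm_num
  have hχ0 : ∀ k x, 0 ≤ χ k x := fun k x ↦ sq_nonneg _
  have hχlim : ∀ x, Tendsto (fun k ↦ χ k x) atTop (𝓝 1) := fun x ↦ by
    refine tendsto_const_nhds.congr' ?_
    obtain ⟨K, hK⟩ := exists_nat_ge (f x)
    filter_upwards [eventually_ge_atTop K] with k hk
    have h1 : φ (f x / (k + 1)) = 1 := by
      refine hφ1 _ ?_
      rw [div_le_one (by positivity)]
      calc f x ≤ K := hK
        _ ≤ k := by exact_mod_cast hk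
        _ ≤ k + 1 := by linarith
    simp [hχ, h1]
  have iχF : ∀ k, Integrable (fun x ↦ χ k x * F x) g.riemVolume := fun k ↦
    ((hχc k).mul hFc).integrable_of_hasCompactSupport (hχsupp k).mul_right
  have hK : ∀ k : ℕ, ∫ x, χ k x * F x ∂g.riemVolume ≤
      2 / 3 * ((∫ x, g.scalarCurvature x * Real.exp (-f x / τ) ∂g.riemVolume) +
        2 * (|1 - τ⁻¹| + 2 * C) ^ 2 * ∫ x, f x ^ 2 * Real.exp (-f x / τ) ∂g.riemVolume) := fun k ↦ by
    have hk1 : (1 : ℝ) ≤ k + 1 := by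
      have : (0 : ℝ) ≤ k := Nat.cast_nonneg k
      linarith
    exact ricciNormSq_cutoff_integral_le hg hf hsol hnorm hprop hR0 hφs hφ0 hφ01 hC hk1 hτ
  exact integrable_of_forall_integral_cutoff_mul_le hFc.aestronglyMeasurable hF0 hχ0 iχF hχlim hK

/-- **`g⁻¹(dR, df) e^{-f/τ}` is integrable for every `τ > 0`** on a gradient shrinker with proper
potential and `R ≥ 0`: `|g⁻¹(dR, df)| ≤ 2 √|Ric|² f ≤ |Ric|² + f²` (`ricciNormSq_abs_innerDual_le`), and
`|Ric|² e^{-f/τ}`, `f² e^{-f/τ}` are integrable (`ricciNormSq_integrable`,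
`secondWeightedIdentity_integrable`). -/
theorem ricciNormSq_innerDual_integrable (hg : g.IsRiemannian) (hf : ContMDiff (𝓡 n) 𝓘(ℝ, ℝ) ∞ f)
    (hsol : ∀ (x : M) (X Y : TangentSpace (𝓡 n) x),
      g.ricci x X Y + g.hessian f x X Y = (1 / 2 : ℝ) * g.val x X Y)
    (hnorm : ∀ x : M, g.scalarCurvature x + g.gradSq f x = f x)
    (hprop : ∀ R : ℝ, IsCompact {x | f x ≤ R}) (hR0 : ∀ x, 0 ≤ g.scalarCurvature x) {τ : ℝ}
    (hτ : 0 < τ) :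
    Integrable (fun x ↦ g.innerDual x (mvfderiv (𝓡 n) g.scalarCurvature x).toLinearMap
      (mvfderiv (𝓡 n) f x).toLinearMap * Real.exp (-f x / τ)) g.riemVolume := by
  have iN := ricciNormSq_integrable hg hf hsol hnorm hprop hR0 hτ
  obtain ⟨iF2, -⟩ := secondWeightedIdentity_integrable hg hf hsol hnorm hprop hR0 hτ
  have hS1 : ContMDiff (𝓡 n) 𝓘(ℝ, ℝ) 1 g.scalarCurvature :=
    (PseudoRiemannianMetric.contMDiff_scalarCurvature g).of_le ENat.LEInfty.out
  have hf1 : ContMDiff (𝓡 n) 𝓘(ℝ, ℝ) 1 f := hf.of_le ENat.LEInfty.out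
  have hXc : Continuous fun x ↦ g.innerDual x (mvfderiv (𝓡 n) g.scalarCurvature x).toLinearMap
      (mvfderiv (𝓡 n) f x).toLinearMap := continuous_innerDual_mvfderiv g hS1 hf1
  have hEc : Continuous fun x ↦ Real.exp (-f x / τ) :=
    Real.continuous_exp.comp (hf.continuous.neg.div_const _)
  have i12 : Integrable (fun x ↦ g.normSq x (g.ricci x) * Real.exp (-f x / τ) +
      f x ^ 2 * Real.exp (-f x / τ)) g.riemVolume := iN.add iF2
  refine i12.mono (hXc.mul hEc).aestronglyMeasurable (Eventually.of_forall fun x ↦ ?_)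
  have hv0 : 0 < Real.exp (-f x / τ) := Real.exp_pos _
  have hN0 : 0 ≤ g.normSq x (g.ricci x) := g.normSq_nonneg x hg _
  have hs0 : 0 ≤ Real.sqrt (g.normSq x (g.ricci x)) := Real.sqrt_nonneg _
  have hss : Real.sqrt (g.normSq x (g.ricci x)) ^ 2 = g.normSq x (g.ricci x) := Real.sq_sqrt hN0
  have hX := ricciNormSq_abs_innerDual_le hg hf hsol hnorm hR0 x
  have h0 : 0 ≤ g.normSq x (g.ricci x) * Real.exp (-f x / τ) + f x ^ 2 * Real.exp (-f x / τ) := by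
    positivity
  rw [Real.norm_eq_abs, abs_mul, abs_of_pos hv0, Real.norm_eq_abs, abs_of_nonneg h0, ← add_mul]
  refine mul_le_mul_of_nonneg_right (hX.trans ?_) hv0.le
  nlinarith [sq_nonneg (Real.sqrt (g.normSq x (g.ricci x)) - f x)]

end ProperGreen

/-! ## The registered helper (n = 4, crux vocabulary) -/

/-- **Helper `helper_ricciNormSq_integrable` of line `Sketch`** (Munteanu–Sesum 2013: the weighted
`L²` bound for `Ric` at every scale, `n = 4`): on every complete connected normalised 4-d gradient
shrinking Ricci soliton and for every `τ > 0`, `|Ric|² e^{-f/τ}` and `g⁻¹(dR, df) e^{-f/τ}` are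
`dV`-integrable (`dV` the Riemannian measure of `g.toContMDiffRiemannianMetric hg`, to which
`g.riemVolume` unfolds by `riemVolume_eq`): `R ≥ 0` and properness of `f`
(`NoncompactShrinkerGapCarrilloNiClauses.scalarCurvature_nonneg_and_isCompact_sublevel`), then
`ricciNormSq_integrable` and `ricciNormSq_innerDual_integrable`. -/
theorem helper_ricciNormSq_integrable : ∀ (M : Type) [TopologicalSpace M] [T2Space M] [SecondCountableTopology M] [ChartedSpace (EuclideanSpace ℝ (Fin 4)) M] [IsManifold (𝓡 4) ∞ M] [ConnectedSpace M] [T3Space M] [MeasurableSpace M] [BorelSpace M] (g : Literature.Geometry.Lorentzian.PseudoRiemannianMetric (𝓡 4) ∞ (EuclideanSpace ℝ (Fin 4)) (TangentSpace (𝓡 4) : M → Type _)) [g.HasLeviCivita] (f : M → ℝ) (hg : g.IsRiemannian), (∀ (x : M) (r : NNReal), IsCompact {y : M | g.edist hg x y ≤ r}) → ContMDiff (𝓡 4) 𝓘(ℝ, ℝ) ∞ f → (∀ (x : M) (X Y : TangentSpace (𝓡 4) x), g.ricci x X Y + g.hessian f x X Y = (1 / 2 : ℝ) * g.val x X Y)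 → (∀ x : M, g.scalarCurvature x + g.gradSq f x = f x) → ∀ τ : ℝ, 0 < τ → MeasureTheory.Integrable (fun x ↦ g.normSq x (g.ricci x) * Real.exp (-f x / τ)) (Literature.Geometry.Lorentzian.riemannianMeasure (g.toContMDiffRiemannianMetric hg)) ∧ MeasureTheory.Integrable (fun x ↦ g.innerDual x (mvfderiv (𝓡 4) g.scalarCurvature x).toLinearMap (mvfderiv (𝓡 4) f x).toLinearMap * Real.exp (-f x / τ)) (Literature.Geometry.Lorentzian.riemannianMeasure (g.toContMDiffRiemannianMetric hg)) := by
  intro M _ _ _ _ _ _ _ _ _ g _ f hg hc hf hsol hnorm τ hτ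
  obtain ⟨hR0, -, hprop⟩ :=
    NoncompactShrinkerGapCarrilloNiClauses.scalarCurvature_nonneg_and_isCompact_sublevel g f hg hc hf
      hsol hnorm
  rw [← PseudoRiemannianMetric.riemVolume_eq hg]
  exact ⟨ricciNormSq_integrable hg hf hsol hnorm hprop hR0 hτ,
    ricciNormSq_innerDual_integrable hg hf hsol hnorm hprop hR0 hτ⟩

end Summit.SmoothPoincare4.SmoothPoincare4.Theorems.ConicalGapSketch

end
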